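/-
Copyright (c) 2026 the pub-hodgecm-mathlib formalisation cell (harness21).  Prover seat hodgecm-mathlib-LH4-p04 (g7), req620 Track A «(D-RAM) FOUR-FRAME» squad
(STAGE-1b, row (2); the type-RamM ALIVE-OFFSET twin of LH4-p07 (g9)'s ★ p859832 `toricCensusSum_ramK_cut_offset`, over this seat's ★ p859810 `toricCensusSum_ramM_cut`;
consumer LH4-p07 (g9) (LAW END, the RamM weld); dealer∕pen LH4-plan (g13)), 2026-09-04.
-/
import Summits.HodgeConjecture.HodgeConjecture.Theorems.F0P3cDyRamToricCensusSumRamMCutoff     -- ★ p859810 (this seat): `toricCensusSum_ramM_cut` (T5s-RamM with a diagonal cutoff)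
import Summits.HodgeConjecture.HodgeConjecture.Theorems.F0P3cDyRamToricCensusSumRamKCutOffset  -- ★ p859832 (LH4-p07 (g9)): `cutSum_eq_of_agree_below_alive` (the re-cut step, type-free)
import HarnessLib

/-!
# Crux `H413`, line LH4 «(D-RAM) FOUR-FRAME» — STAGE-1b, row (2): (T5-P-coneΔ-R2)-RamM, ALIVE OFFSET «THE CUT WELD DOES NOT SEE THE SCALED MULTIPLIER'S ALIVE SHIFT»
# `hvTop` with `2j + d_E ≤ 2jl + 1 + e` in place of `2j + d_E ≤ 2jl + 1`, cutoff `C + d_E ≤ m + jl + 1` ⇒ the cut weld has ★ p859810's value VERBATIM (`d_E = g + s0`)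

Cell `hodgecm-mathlib` (D-0151), FLOOR 0, crux item H413 = `stmt-HodgeConjecture-24833`, route of record `HCCMUnconditional`; squad F0∕P3c∕LH4; lane
`--supports stmt-HodgeConjecture-24833 --as helper` (count-neutral; pays NO tier-0 row).  THEOREMS ONLY (no `def`, no instance, no notation, no `sorry`, default heartbeats).
THE POINT (LH4-p07 (g9)'s ★ p859832, type RamK standard class): the cone cells of a template piece are the cells of a SCALED multiplier, whose top-diagonal ALIVE law reads with the
UNSCALED conductor — in the scaled tokens `(m₁, jl₁)` the `hvTop` sentence carries the alive condition `2j + d ≤ 2jl₁ + 1 + e` with an OFFSET `e = a′`; under `C + d ≤ m + jl + 1` every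
top cell inside the cutoff is alive at the standard boundary, so the tables may be re-cut there without changing the cut sum (★ `cutSum_eq_of_agree_below_alive`, type-free, imported)
and the standard cut weld applies.  ★ p859832 does this for ★ p859753 (RamK, standard class), LH4-p07 (g9)'s `…RamKWeldCutFlip` §1 for RamK♭, LH4-p08 (g8) for type U (v5, both
classes), this seat's `…RamMFlipCutoff` §2 for RamM♭; THIS FILE supplies the type-RamM standard-class sheet:
* **`toricCensusSum_ramM_cut_offset`** — ★ T5s-RamM `toricCensusSum_ramM`'s binders with `hvTopE` (alive `2j + (g+s0) ≤ 2jl + 1 + e`, `(e : ℕ)` before it, ★ p859832's layout) +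
  `(C) (hC : jl ≤ C) (hCe : C + (g + s0) ≤ m + jl + 1)` ⊢ ★ p859810 `toricCensusSum_ramM_cut`'s conclusion VERBATIM (proof: re-cut tables `wP ∕ wM`, ★ `cutSum_eq_of_agree_below_alive`
  at `d := g + s0`, ★ p859810).
HONEST LABEL.  Count-neutral finite-sum bookkeeping over `ℚ` on ABSTRACT tables; the value of `e` for the pieces is the (D3♯) organ's to prove, not asserted here; no census law is
stated; `HC_CM` is proved only modulo the 7 printed citations (2 remaining named inputs: hLiu418 = `stmt-HodgeConjecture-24832`, h413 = `stmt-HodgeConjecture-24833`) until rung 0 closes.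
## References
* [Kottwitz1986BaseChangeUnits] R. E. Kottwitz, *Base change for unit elements of Hecke algebras*, Compositio Math. 60 (1986): §1 pp. 240–241.
* [Rogawski1990] J. D. Rogawski, *Automorphic Representations of Unitary Groups in Three Variables*, Ann. of Math. Stud. 123 (1990): §4.9 Prop. 4.9.1 (b) p. 55, Lemma 4.9.3 p. 56.
* [Flicker1998UnitaryFL] Y. Z. Flicker, *Elementary proof of the fundamental lemma for a unitary group*, Canad. J. Math. 50 (1998): Prop. 7 p. 84 (the level tables).
-/

set_option autoImplicit false

namespace Summit.HodgeConjecture.HodgeConjecture.Cruxes.H413.F0P3cDyRamToricCensusSumRamMCutOffset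

open Finset
open Summit.HodgeConjecture.HodgeConjecture.Cruxes.H413.F0P3cDyRamToricCensusSumRamMCutoff (toricCensusSum_ramM_cut)
open Summit.HodgeConjecture.HodgeConjecture.Cruxes.H413.F0P3cDyRamToricCensusSumRamKCutOffset (cutSum_eq_of_agree_below_alive)


/-- **(T5-P-coneΔ-R2)-RamM WITH AN ALIVE OFFSET.**  ★ T5s `toricCensusSum_ramM`'s binders with the top rows' alive condition SHIFTED to `2j + d_E ≤ 2jl + 1 + e` (`hvTopE`, any
`e : ℕ`; `d_E = g + s0`; the cells of a SCALED multiplier are alive up to the UNSCALED conductor, `e = a′`), a cutoff `C` with `jl ≤ C` and `C + d_E ≤ m + jl + 1` (the offset band is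
cut): the cut weld has ★ p859810 `toricCensusSum_ramM_cut`'s value VERBATIM.  Proof = ★ p859832's two steps (re-cut tables, `cutSum_eq_of_agree_below_alive` at `d := g + s0`), then ★ p859810.
[cite: Kottwitz1986BaseChangeUnits, §1 pp. 240–241] [cite: Rogawski1990, §4.9 Prop. 4.9.1 (b) p. 55, Lemma 4.9.3 p. 56] [cite: Flicker1998UnitaryFL, Prop. 7 p. 84] -/
theorem toricCensusSum_ramM_cut_offset (q : ℕ) {g s0 jl m : ℕ} (ε : ℚ) (hq : 2 ≤ q) (hg : 1 ≤ g) (hs0 : 1 ≤ s0) (hjl : jl % 2 = g % 2)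
    (hjlS : 3 * g + 2 * s0 ≤ jl + 2 + 2 * ((g + s0) % 2)) (hpar : m % 2 = (g + s0) % 2) (hmS : g + s0 - (g + s0) % 2 ≤ m + 1) (hm : m ≤ jl)
    (hε : ε = 1 ∨ (ε = -1 ∧ jl + 2 ≤ m + 2 * g + s0))
    (nP nM vP vM : ℕ → ℕ → ℚ)
    (hnP : ∀ j a, nP j a = ((if j = 0 then (if a = 0 then 1 else 0) else if j < a then 0
      else if j - a + 1 = s0 then q ^ j else if j - a + 1 < s0 then (if a = 0 then q ^ j else 0) else if (j - a - s0) % 2 = 1 then 0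
      else if a = 0 then (if 2 * g ≤ j - a - s0 then 2 else 1) * q ^ (j - (j - a - s0) / 2)
      else if j - a - s0 + 2 < 2 * g then (q - 1) * q ^ (j - 1 - (j - a - s0) / 2) else if j - a - s0 + 2 = 2 * g then (q - 2) * q ^ (j - 1 - (j - a - s0) / 2)
      else 2 * (q - 1) * q ^ (j - 1 - (j - a - s0) / 2) : ℕ) : ℚ))
    (hnM : ∀ j a, nM j a = ((if j = 0 then (if a = 0 then 1 else 0) else if j < a then 0
      else if j - a + 1 = s0 then q ^ j else if j - a + 1 < s0 then (if a = 0 then q ^ j else 0) else if (j - a - s0) % 2 = 1 then 0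
      else if a = 0 then (if j - a - s0 + 2 ≤ 2 * g then q ^ (j - (j - a - s0) / 2) else 0)
      else if j - a - s0 + 2 < 2 * g then (q - 1) * q ^ (j - 1 - (j - a - s0) / 2) else if j - a - s0 + 2 = 2 * g then q ^ (j - (j - a - s0) / 2) else 0 : ℕ) : ℚ))
    (hvGen : ∀ j a, (a ≤ m ∧ (j + a ≤ m ∨ (2 * a ≤ m ∧ j + a ≤ jl))) → vP j a = nP j a ∧ vM j a = nM j a)
    (hvOff : ∀ j a, ¬ (a ≤ m ∧ (j + a ≤ m ∨ (2 * a ≤ m ∧ j + a ≤ jl))) → j + m ≠ jl + a → vP j a = 0 ∧ vM j a = 0)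
    (e : ℕ)
    (hvTopE : ∀ j a, ¬ (a ≤ m ∧ (j + a ≤ m ∨ (2 * a ≤ m ∧ j + a ≤ jl))) → j + m = jl + a →
      (vP j a = if 2 * j + (g + s0) ≤ 2 * jl + 1 + e ∧ (j + a + 2 ≤ m + s0 + 2 * g ∨ ε = 1) then
          (if j + a < m + s0 then (q : ℚ) ^ j else (if 2 * g ≤ j + a - m - s0 + 1 then 2 else 1) * (q : ℚ) ^ (j - (j + a - m - s0 + 1) / 2)) else 0) ∧
      (vM j a = if 2 * j + (g + s0) ≤ 2 * jl + 1 + e ∧ (j + a + 2 ≤ m + s0 + 2 * g ∨ ε = -1) then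
          (if j + a < m + s0 then (q : ℚ) ^ j else (if 2 * g ≤ j + a - m - s0 + 1 then 2 else 1) * (q : ℚ) ^ (j - (j + a - m - s0 + 1) / 2)) else 0))
    (C : ℕ) (hC : jl ≤ C) (hCe : C + (g + s0) ≤ m + jl + 1) :
    ε * ∑ j ∈ range (jl + 1), ∑ a ∈ range (jl + 2), (q : ℚ) ^ a * (if j + a ≤ C then vP j a - vM j a else 0) =
      (q : ℚ) ^ m * (2 * ∑ i ∈ range ((jl - g) / 2 + 1), (q : ℚ) ^ i - 2 * ∑ i ∈ range (g + s0 - (g + s0) % 2), (q : ℚ) ^ i) -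
        2 * ∑ a ∈ (range (jl + 2)).filter (fun a => a ≤ m ∧ C + m < jl + 2 * a ∧ 2 * m + 2 * g + s0 < jl + 2 * a + 2 ∧ 2 * a + (g + s0) ≤ 2 * m + 1), (q : ℚ) ^ (a + (jl + s0) / 2) := by
  classical
  -- the standard-alive tables: the given ones, re-cut at the standard alive boundary on the top diagonal
  set wP : ℕ → ℕ → ℚ := fun j a => if ¬ (a ≤ m ∧ (j + a ≤ m ∨ (2 * a ≤ m ∧ j + a ≤ jl))) ∧ j + m = jl + a then
      (if 2 * j + (g + s0) ≤ 2 * jl + 1 ∧ (j + a + 2 ≤ m + s0 + 2 * g ∨ ε = 1) then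
          (if j + a < m + s0 then (q : ℚ) ^ j else (if 2 * g ≤ j + a - m - s0 + 1 then 2 else 1) * (q : ℚ) ^ (j - (j + a - m - s0 + 1) / 2)) else 0)
    else vP j a with hwP
  set wM : ℕ → ℕ → ℚ := fun j a => if ¬ (a ≤ m ∧ (j + a ≤ m ∨ (2 * a ≤ m ∧ j + a ≤ jl))) ∧ j + m = jl + a then
      (if 2 * j + (g + s0) ≤ 2 * jl + 1 ∧ (j + a + 2 ≤ m + s0 + 2 * g ∨ ε = -1) then
          (if j + a < m + s0 then (q : ℚ) ^ j else (if 2 * g ≤ j + a - m - s0 + 1 then 2 else 1) * (q : ℚ) ^ (j - (j + a - m - s0 + 1) / 2)) else 0)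
    else vM j a with hwM
  have hwGen : ∀ j a, (a ≤ m ∧ (j + a ≤ m ∨ (2 * a ≤ m ∧ j + a ≤ jl))) → wP j a = nP j a ∧ wM j a = nM j a := fun j a hg => by
    obtain ⟨h1, h2⟩ := hvGen j a hg
    rw [hwP, hwM]; dsimp only
    rw [if_neg (fun h => h.1 hg), if_neg (fun h => h.1 hg), h1, h2]
    exact ⟨rfl, rfl⟩
  have hwOff : ∀ j a, ¬ (a ≤ m ∧ (j + a ≤ m ∨ (2 * a ≤ m ∧ j + a ≤ jl))) → j + m ≠ jl + a → wP j a = 0 ∧ wM j a = 0 := fun j a hg hoff => by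
    obtain ⟨h1, h2⟩ := hvOff j a hg hoff
    rw [hwP, hwM]; dsimp only
    rw [if_neg (fun h => hoff h.2), if_neg (fun h => hoff h.2), h1, h2]
    exact ⟨rfl, rfl⟩
  have hwTop : ∀ j a, ¬ (a ≤ m ∧ (j + a ≤ m ∨ (2 * a ≤ m ∧ j + a ≤ jl))) → j + m = jl + a →
      (wP j a = if 2 * j + (g + s0) ≤ 2 * jl + 1 ∧ (j + a + 2 ≤ m + s0 + 2 * g ∨ ε = 1) then
          (if j + a < m + s0 then (q : ℚ) ^ j else (if 2 * g ≤ j + a - m - s0 + 1 then 2 else 1) * (q : ℚ) ^ (j - (j + a - m - s0 + 1) / 2)) else 0) ∧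
      (wM j a = if 2 * j + (g + s0) ≤ 2 * jl + 1 ∧ (j + a + 2 ≤ m + s0 + 2 * g ∨ ε = -1) then
          (if j + a < m + s0 then (q : ℚ) ^ j else (if 2 * g ≤ j + a - m - s0 + 1 then 2 else 1) * (q : ℚ) ^ (j - (j + a - m - s0 + 1) / 2)) else 0) :=
    fun j a hg htop => by
    have hc : ¬ (a ≤ m ∧ (j + a ≤ m ∨ (2 * a ≤ m ∧ j + a ≤ jl))) ∧ j + m = jl + a := ⟨hg, htop⟩
    rw [hwP, hwM]; dsimp only
    rw [if_pos hc, if_pos hc]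
    exact ⟨rfl, rfl⟩
  -- the two cut sums agree: the tables differ only on top cells beyond the standard alive boundary, and those are cut
  have hagree : ∀ j a, ¬ (j + m = jl + a ∧ 2 * jl + 1 < 2 * j + (g + s0)) → vP j a = wP j a ∧ vM j a = wM j a := fun j a hna => by
    rw [hwP, hwM]; dsimp only
    by_cases hcase : ¬ (a ≤ m ∧ (j + a ≤ m ∨ (2 * a ≤ m ∧ j + a ≤ jl))) ∧ j + m = jl + a
    · rw [if_pos hcase, if_pos hcase]
      obtain ⟨hP, hM⟩ := hvTopE j a hcase.1 hcase.2
      have halive : 2 * j + (g + s0) ≤ 2 * jl + 1 := by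
        by_contra hlt
        exact hna ⟨hcase.2, by omega⟩
      have hiffP : (2 * j + (g + s0) ≤ 2 * jl + 1 + e ∧ (j + a + 2 ≤ m + s0 + 2 * g ∨ ε = 1)) ↔ (2 * j + (g + s0) ≤ 2 * jl + 1 ∧ (j + a + 2 ≤ m + s0 + 2 * g ∨ ε = 1)) := by
        constructor <;> rintro ⟨h1, h2⟩ <;> exact ⟨by omega, h2⟩
      have hiffM : (2 * j + (g + s0) ≤ 2 * jl + 1 + e ∧ (j + a + 2 ≤ m + s0 + 2 * g ∨ ε = -1)) ↔ (2 * j + (g + s0) ≤ 2 * jl + 1 ∧ (j + a + 2 ≤ m + s0 + 2 * g ∨ ε = -1)) := by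
        constructor <;> rintro ⟨h1, h2⟩ <;> exact ⟨by omega, h2⟩
      rw [hP, hM, if_congr hiffP rfl rfl, if_congr hiffM rfl rfl]
      exact ⟨rfl, rfl⟩
    · rw [if_neg hcase, if_neg hcase]
      exact ⟨rfl, rfl⟩
  rw [cutSum_eq_of_agree_below_alive (q : ℚ) hCe vP vM wP wM hagree]
  exact toricCensusSum_ramM_cut q ε hq hg hs0 hjl hjlS hpar hmS hm hε nP nM wP wM hnP hnM hwGen hwOff hwTop C hC

end Summit.HodgeConjecture.HodgeConjecture.Cruxes.H413.F0P3cDyRamToricCensusSumRamMCutOffset
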